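import Mathlib
import HarnessLib

/-!
# QUANT lane R8, front "FAR beyond trees", layer one — THE DEGREE-THREE GATE AT THE OBSERVER, XLVI: CHART C — the `(σ, u)`-blow-up in which
# the 8-cell statement is POLYNOMIAL AND REGULAR DOWN TO `p = 0`

builds on p205010 (kernel theorem, internal audit signed; external expert review pending)

Support file (`--supports stmt-CriticalPhenomena-4575`), seat `prim-quant-p1` (gen 32); memo
`run/shared/lean/prim/quant/prim-quant-p1-g32/FOR-LEAD-GATE3-CHARTC.md`.  Pure real algebra (Mathlib only); standard axioms; no sorries;
no definitions.

THE POINT.  In the 8-cell bad-form statement `hred8 (p, r₁, r₂, nn)` (hypothesis `h8` of `Gate3.red_of_red8`, file XXX) the only way the number of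
outside relays `nn` and the gate weight `p` enter a certificate that is uniform in the parameters is through `σ := nn·p` and `u := 1/nn`.  After the
substitution `p = σ·u`, `nn = 1/u` and the rescaling of three cells — `a2 = p·A2`, `bᵢ = u·Bᵢ`, `d = p·D` — every form and every Harris row becomes a
POLYNOMIAL in `(σ, u, r₁, r₂)` (multidegree `(2,2,1,1)`): `g_v / p`, `g₁ / u`, `g₂ / u`, `g_S`, `E`, rows `U1/u, U2/u, U3/u, K1/u, K2/u, K3`.
This file proves the reduction `Gate3.red8_of_chartC`: infeasibility of that CHART-C system at `(σ, u) = (nn·p, 1/nn)` implies `hred8 (p, r₁, r₂, nn)`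
(for `p > 0`, `nn > 0`).  Why it matters (memo §2–§3): the chart system is REGULAR on the CLOSED rectangle `σ ∈ [0, Σ]`, `u ∈ [0, 1]` — its faces
`σ = 0` (every way of letting `p → 0`) and `u = 0` (`nn → ∞` at fixed `σ`) carry pointwise degree-2 certificates with positive margin (e.g. at
`σ = u = 0`: `(B1 + B2)·GS + K1 + K2 = −(B1 + B2)(r₁(1−r₂)B1 + r₂(1−r₁)B2)`), so the small-`p` end of the degree-three gate is ONE compact
box-certificate problem in four variables — no `nn`-windows, no `log log (1/p)` chains (the obstruction met by `σ`-constant windows, g31 memo §4).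
[cite: KozmaNitzan2024, Conjecture 3 (p. 15)]; [this work].
-/

noncomputable section

namespace Summit.CriticalPhenomena.PercolationContinuityZ3.Theorems

namespace Quant

namespace Gate3

/-- **Chart C reduction.**  If the rescaled, polynomial CHART-C system (cells `a0 a1 A2 B1 B2 c0 c1 D`; six rows `U1/u, U2/u, U3/u, K1/u,
K2/u, K3`; five forms `g_v/p, g₁/u, g₂/u, g_S, E`) has no bad point at `(σ, u) = (nn·p, 1/nn)`, then the 8-cell statement `hred8 (p, r₁, r₂, nn)`
holds (`p > 0`, `nn > 0`; no condition on `r₁, r₂`). [this work] -/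
theorem red8_of_chartC (p r₁ r₂ nn σ u : ℝ) (hp : 0 < p) (hn : 0 < nn) (hσ : σ = nn * p) (hu : u = 1 / nn)
    (hC : ∀ (a0 a1 A2 B1 B2 c0 c1 D : ℝ), 0 ≤ a0 → 0 ≤ a1 → 0 ≤ A2 → 0 ≤ B1 → 0 ≤ B2 → 0 ≤ c0 → 0 ≤ c1 → 0 ≤ D →
        B1 * (u * B2 + (c0 + c1)) ≤ σ * D * (a0 + a1 + σ * u * A2) →
        B2 * (u * B1 + (c0 + c1)) ≤ σ * D * (a0 + a1 + σ * u * A2) →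
        (c0 + c1) * (B1 + B2) ≤ σ * D * (a0 + a1 + σ * u * A2) →
        B1 * (a1 + σ * u * A2 + c1 + σ * u * D) ≤ σ * D * (a0 + u * B1 + u * B2 + c0) →
        B2 * (a1 + σ * u * A2 + c1 + σ * u * D) ≤ σ * D * (a0 + u * B1 + u * B2 + c0) →
        c0 * (a1 + σ * u * A2 + c1 + σ * u * D) ≤ (c1 + σ * u * D) * (a0 + u * B1 + u * B2 + c0) →
        0 < ((1 - r₁) * (1 - r₂)) * (a0 + c0) - (1 - σ * u) * A2 - (1 - σ * u) * ((1 - r₁) * (1 - r₂)) * D →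
        0 < (1 - σ * u) * (1 - r₁) * B1 - σ * (r₂ * (1 - r₁)) * a0 - σ * (1 - r₁) * a1 - σ * (1 - σ * u * r₁) * A2 - (1 - (1 - σ * u) * (1 - r₂)) * (1 - r₁) * B2 - σ * ((1 - r₁) * (1 - r₂)) * c1 →
        0 < (1 - σ * u) * (1 - r₂) * B2 - σ * (r₁ * (1 - r₂)) * a0 - σ * (1 - r₂) * a1 - σ * (1 - σ * u * r₂) * A2 - (1 - (1 - σ * u) * (1 - r₁)) * (1 - r₂) * B1 - σ * ((1 - r₁) * (1 - r₂)) * c1 →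
        0 < (1 - σ * u * max r₁ r₂ - σ * (1 - max r₁ r₂)) * a1 + (1 - σ * u * (r₁ + r₂ * (1 - r₁)) - σ * ((1 - r₁) * (1 - r₂))) * c1 - σ * (r₁ + r₂ * (1 - r₁) - max r₁ r₂) * a0 - ((1 - (1 - σ * u) * (1 - r₁)) * (1 - r₂)) * B1 - ((1 - (1 - σ * u) * (1 - r₂)) * (1 - r₁)) * B2 →
        0 < (σ * u * (1 + r₁ + r₂) + σ * max r₁ r₂ - 2) * a0 + (σ * u * (1 + r₁ + r₂) + σ * max r₁ r₂ - σ * u * max r₁ r₂ - 1) * a1 + σ * (σ * u * u * (1 + r₁ + r₂) + 1 - 2 * u) * A2 + ((1 - (1 - σ * u) * (1 - r₁)) * (u + r₂ * (1 + u)) - u) * B1 + ((1 - (1 - σ * u) * (1 - r₂)) * (u + r₁ * (1 + u)) - u) * B2 + (σ * u + (σ + 2 * (σ * u)) * (r₁ + r₂ * (1 - r₁)) - 2) * c0 + (σ * u + (σ + σ * u) * (r₁ + r₂ * (1 - r₁)) - 1) * c1 + (σ + σ * u - σ * u * ((1 - σ * u) * ((1 - r₁) * (1 - r₂)))) * D 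→
        False) :
    ∀ (a0 a1 a2 b1 b2 c0 c1 d : ℝ), 0 ≤ a0 → 0 ≤ a1 → 0 ≤ a2 → 0 ≤ b1 → 0 ≤ b2 → 0 ≤ c0 → 0 ≤ c1 → 0 ≤ d →
        b1 * (b2 + (c0 + c1)) ≤ (a0 + a1 + a2) * d →
        b2 * (b1 + (c0 + c1)) ≤ (a0 + a1 + a2) * d →
        (c0 + c1) * (b1 + b2) ≤ (a0 + a1 + a2) * d →
        b1 * (a1 + a2 + c1 + d) ≤ d * (a0 + b1 + b2 + c0) →
        b2 * (a1 + a2 + c1 + d) ≤ d * (a0 + b1 + b2 + c0) →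
        c0 * (a1 + a2 + c1 + d) ≤ (c1 + d) * (a0 + b1 + b2 + c0) →
        0 < p * ((1 - r₁) * (1 - r₂)) * (a0 + c0) - (1 - p) * a2 - (1 - p) * ((1 - r₁) * (1 - r₂)) * d →
        0 < (1 - p) * (1 - r₁) * b1 - p * (r₂ * (1 - r₁)) * a0 - p * (1 - r₁) * a1 - (1 - p * r₁) * a2 - (1 - (1 - p) * (1 - r₂)) * (1 - r₁) * b2 - p * ((1 - r₁) * (1 - r₂)) * c1 →
        0 < (1 - p) * (1 - r₂) * b2 - p * (r₁ * (1 - r₂)) * a0 - p * (1 - r₂) * a1 - (1 - p * r₂) * a2 - (1 - (1 - p) * (1 - r₁)) * (1 - r₂) * b1 - p * ((1 - r₁) * (1 - r₂)) * c1 →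
        0 < (1 - p * max r₁ r₂ - nn * p * (1 - max r₁ r₂)) * a1 + (1 - p * (r₁ + r₂ * (1 - r₁)) - nn * p * ((1 - r₁) * (1 - r₂))) * c1 - nn * p * (r₁ + r₂ * (1 - r₁) - max r₁ r₂) * a0 - nn * ((1 - (1 - p) * (1 - r₁)) * (1 - r₂)) * b1 - nn * ((1 - (1 - p) * (1 - r₂)) * (1 - r₁)) * b2 →
        0 < (p * (1 + r₁ + r₂ + nn * max r₁ r₂) - 2) * a0 + (p * (1 + r₁ + r₂) + p * max r₁ r₂ * (nn - 1) - 1) * a1 + (p * (1 + r₁ + r₂) + nn - 2) * a2 + ((1 - (1 - p) * (1 - r₁)) * (1 + r₂ * (nn + 1)) - 1) * b1 + ((1 - (1 - p) * (1 - r₂)) * (1 + r₁ * (nn + 1)) - 1) * b2 + (p * (1 + (nn + 2) * (r₁ + r₂ * (1 - r₁))) - 2) * c0 + (p * (1 + (nn + 1) * (r₁ + r₂ * (1 - r₁))) - 1) * c1 + (nn + 1 - (1 - p) * ((1 - r₁) * (1 - r₂))) * d →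
        False := by
  intro a0 a1 a2 b1 b2 c0 c1 d ha0 ha1 ha2 hb1 hb2 hc0 hc1 hd hU1 hU2 hU3 hK1 hK2 hK3 hv h1 h2 hS hE
  have hp0 : p ≠ 0 := hp.ne'
  have hn0 : nn ≠ 0 := hn.ne'
  subst hσ hu
  refine hC a0 a1 (a2 / p) (nn * b1) (nn * b2) c0 c1 (d / p) ha0 ha1 (div_nonneg ha2 hp.le) (mul_nonneg hn.le hb1)
    (mul_nonneg hn.le hb2) hc0 hc1 (div_nonneg hd hp.le) ?_ ?_ ?_ ?_ ?_ ?_ ?_ ?_ ?_ ?_ ?_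
  · -- U1 / u
    have e1 : nn * b1 * (1 / nn * (nn * b2) + (c0 + c1)) = nn * (b1 * (b2 + (c0 + c1))) := by field_simp
    have e2 : nn * p * (d / p) * (a0 + a1 + nn * p * (1 / nn) * (a2 / p)) = nn * ((a0 + a1 + a2) * d) := by field_simp
    rw [e1, e2]; exact mul_le_mul_of_nonneg_left hU1 hn.le
  · -- U2 / u
    have e1 : nn * b2 * (1 / nn * (nn * b1) + (c0 + c1)) = nn * (b2 * (b1 + (c0 + c1))) := by field_simp
    have e2 : nn * p * (d / p) * (a0 + a1 + nn * p * (1 / nn) * (a2 / p)) = nn * ((a0 + a1 + a2) * d) := by field_simp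
    rw [e1, e2]; exact mul_le_mul_of_nonneg_left hU2 hn.le
  · -- U3 / u
    have e1 : (c0 + c1) * (nn * b1 + nn * b2) = nn * ((c0 + c1) * (b1 + b2)) := by ring
    have e2 : nn * p * (d / p) * (a0 + a1 + nn * p * (1 / nn) * (a2 / p)) = nn * ((a0 + a1 + a2) * d) := by field_simp
    rw [e1, e2]; exact mul_le_mul_of_nonneg_left hU3 hn.le
  · -- K1 / u
    have e1 : nn * b1 * (a1 + nn * p * (1 / nn) * (a2 / p) + c1 + nn * p * (1 / nn) * (d / p)) = nn * (b1 * (a1 + a2 + c1 + d)) := by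
      field_simp
    have e2 : nn * p * (d / p) * (a0 + 1 / nn * (nn * b1) + 1 / nn * (nn * b2) + c0) = nn * (d * (a0 + b1 + b2 + c0)) := by field_simp
    rw [e1, e2]; exact mul_le_mul_of_nonneg_left hK1 hn.le
  · -- K2 / u
    have e1 : nn * b2 * (a1 + nn * p * (1 / nn) * (a2 / p) + c1 + nn * p * (1 / nn) * (d / p)) = nn * (b2 * (a1 + a2 + c1 + d)) := by
      field_simp
    have e2 : nn * p * (d / p) * (a0 + 1 / nn * (nn * b1) + 1 / nn * (nn * b2) + c0) = nn * (d * (a0 + b1 + b2 + c0)) := by field_simp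
    rw [e1, e2]; exact mul_le_mul_of_nonneg_left hK2 hn.le
  · -- K3
    have e1 : c0 * (a1 + nn * p * (1 / nn) * (a2 / p) + c1 + nn * p * (1 / nn) * (d / p)) = c0 * (a1 + a2 + c1 + d) := by field_simp
    have e2 : (c1 + nn * p * (1 / nn) * (d / p)) * (a0 + 1 / nn * (nn * b1) + 1 / nn * (nn * b2) + c0) =
        (c1 + d) * (a0 + b1 + b2 + c0) := by field_simp
    rw [e1, e2]; exact hK3
  · -- g_v / p
    have e : ((1 - r₁) * (1 - r₂)) * (a0 + c0) - (1 - nn * p * (1 / nn)) * (a2 / p) - (1 - nn * p * (1 / nn)) * ((1 - r₁) * (1 - r₂)) * (d / p) =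
        (1 / p) * (p * ((1 - r₁) * (1 - r₂)) * (a0 + c0) - (1 - p) * a2 - (1 - p) * ((1 - r₁) * (1 - r₂)) * d) := by
      field_simp
    rw [e]; exact mul_pos (one_div_pos.mpr hp) hv
  · -- g₁ / u
    have e : (1 - nn * p * (1 / nn)) * (1 - r₁) * (nn * b1) - nn * p * (r₂ * (1 - r₁)) * a0 - nn * p * (1 - r₁) * a1 -
        nn * p * (1 - nn * p * (1 / nn) * r₁) * (a2 / p) - (1 - (1 - nn * p * (1 / nn)) * (1 - r₂)) * (1 - r₁) * (nn * b2) -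
        nn * p * ((1 - r₁) * (1 - r₂)) * c1 =
        nn * ((1 - p) * (1 - r₁) * b1 - p * (r₂ * (1 - r₁)) * a0 - p * (1 - r₁) * a1 - (1 - p * r₁) * a2 - (1 - (1 - p) * (1 - r₂)) * (1 - r₁) * b2 -
          p * ((1 - r₁) * (1 - r₂)) * c1) := by
      field_simp
    rw [e]; exact mul_pos hn h1
  · -- g₂ / u
    have e : (1 - nn * p * (1 / nn)) * (1 - r₂) * (nn * b2) - nn * p * (r₁ * (1 - r₂)) * a0 - nn * p * (1 - r₂) * a1 -
        nn * p * (1 - nn * p * (1 / nn) * r₂) * (a2 / p) - (1 - (1 - nn * p * (1 / nn)) * (1 - r₁)) * (1 - r₂) * (nn * b1) -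
        nn * p * ((1 - r₁) * (1 - r₂)) * c1 =
        nn * ((1 - p) * (1 - r₂) * b2 - p * (r₁ * (1 - r₂)) * a0 - p * (1 - r₂) * a1 - (1 - p * r₂) * a2 - (1 - (1 - p) * (1 - r₁)) * (1 - r₂) * b1 -
          p * ((1 - r₁) * (1 - r₂)) * c1) := by
      field_simp
    rw [e]; exact mul_pos hn h2
  · -- g_S
    have e : (1 - nn * p * (1 / nn) * max r₁ r₂ - nn * p * (1 - max r₁ r₂)) * a1 +
        (1 - nn * p * (1 / nn) * (r₁ + r₂ * (1 - r₁)) - nn * p * ((1 - r₁) * (1 - r₂))) * c1 -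
        nn * p * (r₁ + r₂ * (1 - r₁) - max r₁ r₂) * a0 - ((1 - (1 - nn * p * (1 / nn)) * (1 - r₁)) * (1 - r₂)) * (nn * b1) -
        ((1 - (1 - nn * p * (1 / nn)) * (1 - r₂)) * (1 - r₁)) * (nn * b2) =
        (1 - p * max r₁ r₂ - nn * p * (1 - max r₁ r₂)) * a1 + (1 - p * (r₁ + r₂ * (1 - r₁)) - nn * p * ((1 - r₁) * (1 - r₂))) * c1 -
          nn * p * (r₁ + r₂ * (1 - r₁) - max r₁ r₂) * a0 - nn * ((1 - (1 - p) * (1 - r₁)) * (1 - r₂)) * b1 -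
          nn * ((1 - (1 - p) * (1 - r₂)) * (1 - r₁)) * b2 := by
      field_simp
    rw [e]; exact hS
  · -- E
    have e : (nn * p * (1 / nn) * (1 + r₁ + r₂) + nn * p * max r₁ r₂ - 2) * a0 +
        (nn * p * (1 / nn) * (1 + r₁ + r₂) + nn * p * max r₁ r₂ - nn * p * (1 / nn) * max r₁ r₂ - 1) * a1 +
        nn * p * (nn * p * (1 / nn) * (1 / nn) * (1 + r₁ + r₂) + 1 - 2 * (1 / nn)) * (a2 / p) +
        ((1 - (1 - nn * p * (1 / nn)) * (1 - r₁)) * (1 / nn + r₂ * (1 + 1 / nn)) - 1 / nn) * (nn * b1) +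
        ((1 - (1 - nn * p * (1 / nn)) * (1 - r₂)) * (1 / nn + r₁ * (1 + 1 / nn)) - 1 / nn) * (nn * b2) +
        (nn * p * (1 / nn) + (nn * p + 2 * (nn * p * (1 / nn))) * (r₁ + r₂ * (1 - r₁)) - 2) * c0 +
        (nn * p * (1 / nn) + (nn * p + nn * p * (1 / nn)) * (r₁ + r₂ * (1 - r₁)) - 1) * c1 +
        (nn * p + nn * p * (1 / nn) - nn * p * (1 / nn) * ((1 - nn * p * (1 / nn)) * ((1 - r₁) * (1 - r₂)))) * (d / p) =
        (p * (1 + r₁ + r₂ + nn * max r₁ r₂) - 2) * a0 + (p * (1 + r₁ + r₂) + p * max r₁ r₂ * (nn - 1) - 1) * a1 + (p * (1 + r₁ + r₂) + nn - 2) * a2 +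
          ((1 - (1 - p) * (1 - r₁)) * (1 + r₂ * (nn + 1)) - 1) * b1 + ((1 - (1 - p) * (1 - r₂)) * (1 + r₁ * (nn + 1)) - 1) * b2 +
          (p * (1 + (nn + 2) * (r₁ + r₂ * (1 - r₁))) - 2) * c0 + (p * (1 + (nn + 1) * (r₁ + r₂ * (1 - r₁))) - 1) * c1 +
          (nn + 1 - (1 - p) * ((1 - r₁) * (1 - r₂))) * d := by
      field_simp
      ring
    rw [e]; exact hE

end Gate3

end Quant

end Summit.CriticalPhenomena.PercolationContinuityZ3.Theorems
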